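import Literature.Analysis.FluidPDE.LocalTypeIWeakSerrinUniform
import Literature.Analysis.FluidPDE.SereginSverakPressureProofs
import Literature.Analysis.FluidPDE.SereginZajaczkowski2007L42
import HarnessLib

/-!
# Strain doors, PART M §M28(a)–(d) — scaled energies of a classical Leray–Hopf solution under the sup-norm
# Type-I rate: the rate interpolation on every parabolic ball of the strip, and the base-scale data

ROUND 69 of the `ns-regularity-ideate` programme (p1 line; helper lane of `stmt-NavierStokesRegularity-0056`,
rung N0; nothing here is a claim about Navier–Stokes regularity).  ROUND 68 proved Barker–Prange's Theorem 3 with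
one fixed `δ₀` on one sequence of slices for solutions which are Type I both in the sup-norm (`|u| ≤ M/√(T − t)`)
and in the `L²`-Morrey sense (`‖u(t)‖_{L²(B_r(y))} ≤ M₂√r`, `T − r² < t < T`), and typed the door X′: «the
sup-norm rate plus the energy class give the Morrey bound with `M₂ = M₂(M, ‖u₀‖₂, T)`».  ROUND 69 PROVES X′ in
three texts: `StrainDoorsSupTypeIScaledEnergies` (§M28(a)–(d): the rate interpolation and the base-scale data),
`StrainDoorsMorreyBoundFromSupTypeI` (§M28(e)–(f): Seregin's iteration with data-uniform constants and the Morrey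
bound), `StrainDoorsFixedDeltaSupTypeI` (§M28(g)–(i): the fixed-`δ₀` criterion and the every-slice concentration
made unconditional in the energy class; door X″ typed).

THIS FILE (tree imports only):
* §M28(a) `lintegral_invSqrt_time_le` (`∫_{t'-ρ²}^{t'} (t − s)^{-1/2} ds ≤ 2ρ`), `eLpNorm_two_le_of_lintegral_sq_le`;
* §M28(b) `cknC_le_of_supRate` — `C(Q) ≤ 4|B₁|^{1/4}|C|^{3/2} A(Q)^{3/4}` on every parabolic ball `Q = Q(z', ρ)`,
  `ρ ≤ 1`, of the strip `(0,T) × ℝ³` (the tree's unit-ball lemma `AlbrittonBarker2019.cknC_le_of_rate` applied to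
  the field cut off below time `0`);
* §M28(c) `cknAEss_le_of_energy` (`A(Q(z', r₀)) ≤ E₀/r₀`, energy inequality), `lintegral_cube_le_of_rate`, and
  `cknD_gauge_le_of_supRate` (`D(Q(z', r₀)) ≤ r₀⁻² C_{3/2}^{3/2}|M|E₀ · 2r₀` for the Seregin–Šverák gauged pressure:
  Stein, the cubic slice under the rate, Tonelli);
* §M28(d) `lintegral_ball_le_of_cknAEss_le` — from the essential supremum to EVERY slice (Fatou, continuity).
No `sorry`, no new axioms, no instances, no notation, no definitions.
-/

noncomputable section

set_option linter.dupNamespace false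

open MeasureTheory Set Function Filter Metric Real
open _root_.Topology
open scoped ENNReal NNReal
open Literature.Analysis Literature.Analysis.FluidPDE

namespace Summit.NavierStokesRegularity.NavierStokesRegularity.Theorems.StrainDoors

/-! ### §M28(a) Two elementary conversions -/

/-- `∫_{t'-ρ²}^{t'} (t - s)^{-1/2} ds ≤ 2ρ` for `t' ≤ t`, `ρ > 0` (the worst case is `t' = t`; subadditivity
of the square root).  The exponent-`½` companion of the tree's
`AlbrittonBarker2019.lintegral_rate_time_le`. [folklore] -/
theorem lintegral_invSqrt_time_le {t t' ρ : ℝ} (ht : t' ≤ t) (hρ : 0 < ρ) :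
    ∫⁻ s in Ioo (t' - ρ ^ 2) t', ENNReal.ofReal ((t - s) ^ (-(1 / 2) : ℝ)) ≤
      ENNReal.ofReal (2 * ρ) := by
  have hab : t' - ρ ^ 2 ≤ t' := by nlinarith
  have hint : IntegrableOn (fun s => (t - s) ^ (-(1 / 2) : ℝ)) (Ioo (t' - ρ ^ 2) t') volume := by
    have h1 : IntervalIntegrable (fun x : ℝ => x ^ (-(1 / 2) : ℝ)) volume (t - (t' - ρ ^ 2)) (t - t') :=
      intervalIntegral.intervalIntegrable_rpow' (by norm_num)
    have h2 := h1.comp_sub_left t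
    simp only [sub_sub_cancel] at h2
    exact ((intervalIntegrable_iff_integrableOn_Ioc_of_le hab).1 h2).mono_set Ioo_subset_Ioc_self
  have hnn : 0 ≤ᵐ[volume.restrict (Ioo (t' - ρ ^ 2) t')] fun s => (t - s) ^ (-(1 / 2) : ℝ) := by
    filter_upwards [ae_restrict_mem measurableSet_Ioo] with s hs
    exact Real.rpow_nonneg (by linarith [hs.2]) _
  rw [← ofReal_integral_eq_lintegral_ofReal hint hnn]
  refine ENNReal.ofReal_le_ofReal ?_
  have heval : ∫ s in Ioo (t' - ρ ^ 2) t', (t - s) ^ (-(1 / 2) : ℝ) =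
      ((t - t' + ρ ^ 2) ^ (1 / 2 : ℝ) - (t - t') ^ (1 / 2 : ℝ)) / (1 / 2 : ℝ) := by
    rw [← integral_Ioc_eq_integral_Ioo, ← intervalIntegral.integral_of_le hab,
      intervalIntegral.integral_comp_sub_left (fun x : ℝ => x ^ (-(1 / 2) : ℝ)) t,
      integral_rpow (Or.inl (by norm_num))]
    congr 1
    · rw [show t - (t' - ρ ^ 2) = t - t' + ρ ^ 2 by ring]; norm_num
    · norm_num
  rw [heval]
  have hα : 0 ≤ t - t' := by linarith
  have hsub : (t - t' + ρ ^ 2) ^ (1 / 2 : ℝ) ≤ (t - t') ^ (1 / 2 : ℝ) + (ρ ^ 2) ^ (1 / 2 : ℝ) :=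
    Real.rpow_add_le_add_rpow hα (by positivity) (by norm_num) (by norm_num)
  have hρ2 : (ρ ^ 2) ^ (1 / 2 : ℝ) = ρ := by
    rw [← Real.sqrt_eq_rpow, Real.sqrt_sq hρ.le]
  rw [div_eq_mul_inv, show ((1 : ℝ) / 2)⁻¹ = 2 by norm_num]
  nlinarith [hsub, hρ2, Real.rpow_nonneg hα (1 / 2 : ℝ)]

/-- `∫ |f|² ≤ a²` (as a `lintegral`, `a ≥ 0`) gives `‖f‖_{L²(μ)} ≤ a` (Mathlib's `eLpNorm`). [folklore] -/
theorem eLpNorm_two_le_of_lintegral_sq_le {α : Type*} [MeasurableSpace α] {μ : Measure α}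
    {f : α → EuclideanSpace ℝ (Fin 3)} {a : ℝ} (ha : 0 ≤ a)
    (h : ∫⁻ x, ‖f x‖ₑ ^ 2 ∂μ ≤ ENNReal.ofReal (a ^ 2)) :
    eLpNorm f 2 μ ≤ ENNReal.ofReal a := by
  rw [eLpNorm_eq_lintegral_rpow_enorm_toReal (by norm_num) (by norm_num)]
  have h2 : (2 : ℝ≥0∞).toReal = 2 := by norm_num
  rw [h2]
  have h' : ∫⁻ x, ‖f x‖ₑ ^ (2 : ℝ) ∂μ ≤ ENNReal.ofReal (a ^ 2) := by
    have e : ∀ x, ‖f x‖ₑ ^ (2 : ℝ) = ‖f x‖ₑ ^ 2 := fun x => by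
      exact_mod_cast ENNReal.rpow_natCast ‖f x‖ₑ 2
    simp only [e]
    exact h
  calc (∫⁻ x, ‖f x‖ₑ ^ (2 : ℝ) ∂μ) ^ (1 / (2 : ℝ))
      ≤ (ENNReal.ofReal (a ^ 2)) ^ (1 / (2 : ℝ)) := ENNReal.rpow_le_rpow h' (by norm_num)
    _ = ENNReal.ofReal a := by
        rw [ENNReal.ofReal_rpow_of_nonneg (sq_nonneg a) (by norm_num),
          show a ^ 2 = a ^ (2 : ℝ) by exact_mod_cast (Real.rpow_natCast a 2).symm, ← Real.rpow_mul ha]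
        norm_num

/-! ### §M28(b) The rate interpolation `C ≤ κ A^{3/4}` on parabolic balls inside the strip -/

/-- **The rate interpolation on every parabolic ball of the strip.** If `u` is continuous on
`[0,T) × ℝ³` and `|u(t,x)| ≤ C/√(T − t)` on `(0,T)` (`C ≥ 0`), then for every parabolic ball `Q(z', ρ)`,
`0 < ρ ≤ 1`, lying in the strip (`ρ² ≤ t' ≤ T`, `z' = (t', x')`):
`C(Q(z', ρ)) ≤ 4|B₁|^{1/4} C^{3/2} · A(Q(z', ρ))^{3/4}`.  Proof: the tree's unit-ball lemma
`AlbrittonBarker2019.cknC_le_of_rate` applied to the field cut off below time `0` (which obeys the rate on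
the whole unit ball `Q(z', 1)` about the same centre, the rate being measured from `t' ≤ T`), the two scaled
quantities of `Q(z', ρ)` seeing only times in `(0, T)`.
[cite: AlbrittonBarker2019, proof of Lemma 2.5 (arXiv:1811.00502 §2), rate case] -/
theorem cknC_le_of_supRate {T C : ℝ}
    {u : ℝ → EuclideanSpace ℝ (Fin 3) → EuclideanSpace ℝ (Fin 3)} (hC : 0 ≤ C)
    (hcont : ContinuousOn (uncurry u) (Ico 0 T ×ˢ (univ : Set (EuclideanSpace ℝ (Fin 3)))))
    (hI : ∀ t ∈ Ioo 0 T, ∀ x : EuclideanSpace ℝ (Fin 3), ‖u t x‖ ≤ C / Real.sqrt (T - t))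
    {z' : ℝ × EuclideanSpace ℝ (Fin 3)} {ρ : ℝ} (hρ : 0 < ρ) (hρ1 : ρ ≤ 1) (hz'T : z'.1 ≤ T)
    (hz'0 : ρ ^ 2 ≤ z'.1) :
    cknC ρ z' u ≤ (4 * volume (ball (0 : EuclideanSpace ℝ (Fin 3)) 1) ^ (1 / 4 : ℝ) *
        ENNReal.ofReal (C ^ (3 / 2 : ℝ))) * cknAEss ρ z' u ^ (3 / 4 : ℝ) := by
  -- the field cut off below time `0`
  set v : ℝ → EuclideanSpace ℝ (Fin 3) → EuclideanSpace ℝ (Fin 3) :=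
    fun s x => if 0 < s then u s x else 0 with hv
  have hS : MeasurableSet {w : ℝ × EuclideanSpace ℝ (Fin 3) | 0 < w.1} :=
    measurableSet_lt measurable_const measurable_fst
  -- measurability of the cut-off field on the unit ball about `z'`
  have hvm : AEStronglyMeasurable (uncurry v) (volume.restrict (parabolicCylinder 1 z')) := by
    have e : uncurry v = Set.indicator {w : ℝ × EuclideanSpace ℝ (Fin 3) | 0 < w.1} (uncurry u) := by
      funext w
      rcases w with ⟨s, x⟩
      simp only [uncurry_apply_pair, hv, Set.indicator_apply, mem_setOf_eq]
    rw [e, aestronglyMeasurable_indicator_iff hS, Measure.restrict_restrict hS]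
    have hsub : {w : ℝ × EuclideanSpace ℝ (Fin 3) | 0 < w.1} ∩ parabolicCylinder 1 z' ⊆
        Ico 0 T ×ˢ (univ : Set (EuclideanSpace ℝ (Fin 3))) := by
      rintro ⟨s, x⟩ ⟨hs, hw⟩
      rw [mem_parabolicCylinder] at hw
      exact ⟨⟨le_of_lt hs, lt_of_lt_of_le hw.1.2 hz'T⟩, mem_univ _⟩
    exact (hcont.mono hsub).aestronglyMeasurable (hS.inter (isOpen_parabolicCylinder 1 z').measurableSet)
  -- the rate on the whole unit ball, measured from `t' = z'.1`
  have hrate : ∀ s y, (s, y) ∈ parabolicCylinder 1 z' → ‖v s y‖ ≤ C / Real.sqrt (z'.1 - s) := by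
    intro s y hmem
    rw [mem_parabolicCylinder] at hmem
    have hsz : s < z'.1 := hmem.1.2
    by_cases hs : 0 < s
    · have hsT : s ∈ Ioo 0 T := ⟨hs, lt_of_lt_of_le hsz hz'T⟩
      have h1 : ‖u s y‖ ≤ C / Real.sqrt (T - s) := hI s hsT y
      have h2 : C / Real.sqrt (T - s) ≤ C / Real.sqrt (z'.1 - s) :=
        div_le_div_of_nonneg_left hC (Real.sqrt_pos.2 (by linarith))
          (Real.sqrt_le_sqrt (by linarith))
      simp only [hv, if_pos hs]
      exact h1.trans h2
    · simp only [hv, if_neg hs, norm_zero]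
      exact div_nonneg hC (Real.sqrt_nonneg _)
  have hsub1 : parabolicCylinder ρ z' ⊆ parabolicCylinder 1 z' := parabolicCylinder_mono hρ.le hρ1 z'
  have key := AlbrittonBarker2019.cknC_le_of_rate hC hvm hrate hρ hsub1
  -- the two scaled quantities of `Q(z', ρ)` do not see the cut
  have hCeq : cknC ρ z' v = cknC ρ z' u := by
    rw [cknC, cknC]
    congr 1
    refine setLIntegral_congr_fun (isOpen_parabolicCylinder ρ z').measurableSet (fun w hw => ?_)
    rw [mem_parabolicCylinder] at hw
    have hw0 : 0 < w.1 := by linarith [hw.1.1]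
    simp only [hv, if_pos hw0]
  have hAeq : cknAEss ρ z' v = cknAEss ρ z' u := by
    rw [cknAEss, cknAEss]
    refine essSup_congr_ae ?_
    filter_upwards [ae_restrict_mem measurableSet_Ioo] with s hs
    have hs0 : 0 < s := by linarith [hs.1]
    simp only [hv, if_pos hs0]
  rw [hCeq, hAeq] at key
  exact key

/-! ### §M28(c) Base-scale data in the energy class -/

/-- **The scaled energy at the base scale** from the Leray–Hopf energy inequality:
`A(Q(z', r₀)) ≤ r₀⁻¹ ∫|u₀|²` for every parabolic ball of the strip (`r₀² ≤ t' ≤ T`). [folklore] -/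
theorem cknAEss_le_of_energy {T E₀ : ℝ}
    {u : ℝ → EuclideanSpace ℝ (Fin 3) → EuclideanSpace ℝ (Fin 3)}
    (hLH : IsLerayHopfOn T 1 0 (u 0) u) (hE₀ : ∫ x, ‖u 0 x‖ ^ 2 ≤ E₀)
    {z' : ℝ × EuclideanSpace ℝ (Fin 3)} {r₀ : ℝ} (hz'T : z'.1 ≤ T) (hz'0 : r₀ ^ 2 ≤ z'.1) :
    cknAEss r₀ z' u ≤ (ENNReal.ofReal r₀)⁻¹ * ENNReal.ofReal E₀ := by
  rw [cknAEss]
  refine essSup_le_of_ae_le _ ?_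
  filter_upwards [ae_restrict_mem measurableSet_Ioo] with s hs
  have hsI : s ∈ Icc 0 T := ⟨by linarith [hs.1], by linarith [hs.2]⟩
  have hkin : 2 * VectorCalculus.kineticEnergy (u 0) ≤ E₀ := by
    rw [VectorCalculus.kineticEnergy, ← mul_assoc, mul_inv_cancel₀ (two_ne_zero), one_mul]
    exact hE₀
  gcongr
  calc ∫⁻ x in ball z'.2 r₀, ‖u s x‖ₑ ^ 2 ≤ ∫⁻ x, ‖u s x‖ₑ ^ 2 := setLIntegral_le_lintegral _ _
    _ ≤ ENNReal.ofReal (2 * VectorCalculus.kineticEnergy (u 0)) :=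
        SereginSverak2002.eEnergy_le zero_le_one hLH hsI
    _ ≤ ENNReal.ofReal E₀ := ENNReal.ofReal_le_ofReal hkin

/-- For `s < T`: `M/√(T − s) ≤ |M| (T − s)^{-1/2}`. [folklore] -/
theorem rate_le_abs_mul_rpow {M T s : ℝ} (hs : s < T) :
    M / Real.sqrt (T - s) ≤ |M| * (T - s) ^ (-(1 / 2) : ℝ) := by
  have hTs : 0 < T - s := sub_pos.2 hs
  have e : (T - s) ^ (-(1 / 2) : ℝ) = (Real.sqrt (T - s))⁻¹ := by
    rw [Real.sqrt_eq_rpow, ← Real.rpow_neg hTs.le]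
  rw [e, ← div_eq_mul_inv]
  exact div_le_div_of_nonneg_right (le_abs_self M) (Real.sqrt_nonneg _)

/-- **The cubic slice under the rate**: `∫|u(s)|³ ≤ |M|(T − s)^{-1/2} ∫|u(s)|²` if `|u(s,·)| ≤ M/√(T − s)`,
`s < T`. [folklore] -/
theorem lintegral_cube_le_of_rate {M T s : ℝ} (hs : s < T)
    {w : EuclideanSpace ℝ (Fin 3) → EuclideanSpace ℝ (Fin 3)} (hw : ∀ x, ‖w x‖ ≤ M / Real.sqrt (T - s)) :
    ∫⁻ x, ‖w x‖ₑ ^ (3 : ℕ) ≤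
      ENNReal.ofReal (|M| * (T - s) ^ (-(1 / 2) : ℝ)) * ∫⁻ x, ‖w x‖ₑ ^ 2 := by
  rw [← lintegral_const_mul' _ _ ENNReal.ofReal_ne_top]
  refine lintegral_mono fun x => ?_
  have hle : ‖w x‖ₑ ≤ ENNReal.ofReal (|M| * (T - s) ^ (-(1 / 2) : ℝ)) := by
    rw [← ofReal_norm]
    exact ENNReal.ofReal_le_ofReal ((hw x).trans (rate_le_abs_mul_rpow hs))
  calc ‖w x‖ₑ ^ (3 : ℕ) = ‖w x‖ₑ * ‖w x‖ₑ ^ 2 := by ring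
    _ ≤ ENNReal.ofReal (|M| * (T - s) ^ (-(1 / 2) : ℝ)) * ‖w x‖ₑ ^ 2 := by gcongr

/-- **The scaled pressure at the base scale**, for the gauged pressure `q = p − (p(t,0) − p̃[u(t)](0))` of a
classical Leray–Hopf solution on `[0,T)` with the rate `|u| ≤ M/√(T − t)` and `∫|u₀|² ≤ E₀`: for every parabolic
ball `Q(z', r₀)` of the strip (`r₀² ≤ t' ≤ T`),
`D(Q(z', r₀)) ≤ r₀⁻² · C_{3/2}^{3/2} |M| E₀ · 2r₀` (`q(s,·) = p̃[u(s)]` for a.e. `s`, Stein's bound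
`∫|p̃|^{3/2} ≤ C^{3/2}∫|u|³`, the cubic slice under the rate, and `∫_{t'-r₀²}^{t'} (T − s)^{-1/2} ds ≤ 2r₀`).
[cite: Stein1971, Ch. II §4.2 Thm. 3; Tao2011, Lemma 4.1 (i)] -/
theorem cknD_gauge_le_of_supRate {T M E₀ : ℝ}
    {u : ℝ → EuclideanSpace ℝ (Fin 3) → EuclideanSpace ℝ (Fin 3)} {p : ℝ → EuclideanSpace ℝ (Fin 3) → ℝ}
    (hT : 0 < T) (hcl : IsClassicalNSSolutionOn (Ico 0 T) 1 0 u p) (hLH : IsLerayHopfOn T 1 0 (u 0) u)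
    (hE₀ : ∫ x, ‖u 0 x‖ ^ 2 ≤ E₀)
    (hI : ∀ t ∈ Ioo 0 T, ∀ x : EuclideanSpace ℝ (Fin 3), ‖u t x‖ ≤ M / Real.sqrt (T - t))
    {z' : ℝ × EuclideanSpace ℝ (Fin 3)} {r₀ : ℝ} (hr₀ : 0 < r₀) (hz'T : z'.1 ≤ T) (hz'0 : r₀ ^ 2 ≤ z'.1) :
    cknD r₀ z' (fun t x => p t x - (p t 0 - normalisedPressure (u t) 0)) ≤
      (ENNReal.ofReal r₀ ^ 2)⁻¹ *
        (((steinConstThreeHalves : ℝ≥0∞) ^ (3 / 2 : ℝ) * ENNReal.ofReal |M| * ENNReal.ofReal E₀) *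
          ENNReal.ofReal (2 * r₀)) := by
  set I : Set ℝ := Ioo (z'.1 - r₀ ^ 2) z'.1 with hIdef
  set C₀ : ℝ≥0∞ := (steinConstThreeHalves : ℝ≥0∞) ^ (3 / 2 : ℝ) with hC₀
  set q : ℝ → EuclideanSpace ℝ (Fin 3) → ℝ :=
    fun t x => p t x - (p t 0 - normalisedPressure (u t) 0) with hq
  have hIT : I ⊆ Ioo 0 T := fun s hs => ⟨by rw [hIdef] at hs; linarith [hs.1], lt_of_lt_of_le hs.2 hz'T⟩
  have hkin : 2 * VectorCalculus.kineticEnergy (u 0) ≤ E₀ := by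
    rw [VectorCalculus.kineticEnergy, ← mul_assoc, mul_inv_cancel₀ (two_ne_zero), one_mul]
    exact hE₀
  -- the gauge identity, a.e. in time
  obtain ⟨hgauge, -⟩ := SereginSverak2002.exists_pressure_gauge_of_classical one_pos hT hcl hLH
  -- the slice bound, a.e. in `s ∈ I`
  have hslice : ∀ᵐ s ∂(volume.restrict I),
      ∫⁻ x, ‖q s x‖ₑ ^ (3 / 2 : ℝ) ≤
        (C₀ * ENNReal.ofReal |M| * ENNReal.ofReal E₀) * ENNReal.ofReal ((T - s) ^ (-(1 / 2) : ℝ)) := by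
    filter_upwards [ae_restrict_of_ae_restrict_of_subset hIT hgauge, ae_restrict_mem measurableSet_Ioo]
      with s hs hsI
    have hsT : s ∈ Ioo 0 T := hIT hsI
    have hsm : ContDiff ℝ (⊤ : ℕ∞) (u s) := hcl.contDiff_velocity ⟨hsT.1.le, hsT.2⟩
    have hL2 : Integrable fun y => ‖u s y‖ ^ 2 :=
      (hLH.memLp s ⟨hsT.1.le, hsT.2.le⟩).integrable_norm_pow two_ne_zero
    have hen : ∫⁻ x, ‖u s x‖ₑ ^ 2 ≤ ENNReal.ofReal E₀ :=
      (SereginSverak2002.eEnergy_le zero_le_one hLH ⟨hsT.1.le, hsT.2.le⟩).trans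
        (ENNReal.ofReal_le_ofReal hkin)
    calc ∫⁻ x, ‖q s x‖ₑ ^ (3 / 2 : ℝ)
        = ∫⁻ x, ‖normalisedPressure (u s) x‖ₑ ^ (3 / 2 : ℝ) := by simp_rw [hq, hs]
      _ ≤ C₀ * ∫⁻ x, ‖u s x‖ₑ ^ (3 : ℕ) := SereginSverak2002.lintegral_normalisedPressure_rpow_le hsm hL2
      _ ≤ C₀ * (ENNReal.ofReal (|M| * (T - s) ^ (-(1 / 2) : ℝ)) * ∫⁻ x, ‖u s x‖ₑ ^ 2) := by
          gcongr
          exact lintegral_cube_le_of_rate hsT.2 (hI s hsT)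
      _ ≤ C₀ * (ENNReal.ofReal (|M| * (T - s) ^ (-(1 / 2) : ℝ)) * ENNReal.ofReal E₀) := by gcongr
      _ = (C₀ * ENNReal.ofReal |M| * ENNReal.ofReal E₀) * ENNReal.ofReal ((T - s) ^ (-(1 / 2) : ℝ)) := by
          rw [ENNReal.ofReal_mul (abs_nonneg M)]; ring
  -- integrate in time
  have hFm : Measurable fun s : ℝ => ENNReal.ofReal ((T - s) ^ (-(1 / 2) : ℝ)) :=
    ENNReal.measurable_ofReal.comp ((measurable_const.sub measurable_id).pow_const _)
  have htime := lintegral_invSqrt_time_le (t := T) hz'T hr₀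
  have hQ : parabolicCylinder r₀ z' ⊆ I ×ˢ (univ : Set (EuclideanSpace ℝ (Fin 3))) :=
    prod_mono subset_rfl (subset_univ _)
  rw [cknD]
  gcongr
  calc ∫⁻ w in parabolicCylinder r₀ z', ‖q w.1 w.2‖ₑ ^ (3 / 2 : ℝ)
      ≤ ∫⁻ w in I ×ˢ (univ : Set (EuclideanSpace ℝ (Fin 3))), ‖q w.1 w.2‖ₑ ^ (3 / 2 : ℝ) :=
        lintegral_mono_set hQ
    _ ≤ ∫⁻ s in I, ∫⁻ x, ‖q s x‖ₑ ^ (3 / 2 : ℝ) :=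
        SereginSverak2002.lintegral_slab_le_lintegral_lintegral I (fun w => ‖q w.1 w.2‖ₑ ^ (3 / 2 : ℝ))
    _ ≤ ∫⁻ s in I, (C₀ * ENNReal.ofReal |M| * ENNReal.ofReal E₀) * ENNReal.ofReal ((T - s) ^ (-(1 / 2) : ℝ)) :=
        lintegral_mono_ae hslice
    _ = (C₀ * ENNReal.ofReal |M| * ENNReal.ofReal E₀) * ∫⁻ s in I, ENNReal.ofReal ((T - s) ^ (-(1 / 2) : ℝ)) := by
        rw [lintegral_const_mul _ hFm]
    _ ≤ (C₀ * ENNReal.ofReal |M| * ENNReal.ofReal E₀) * ENNReal.ofReal (2 * r₀) := by gcongr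

/-! ### §M28(d) From the essential supremum to every slice -/

/-- **Every slice of a classical solution obeys the scaled-energy bound**: if `u` is continuous on
`[0,T) × ℝ³`, `Q(z', ρ)` lies in the strip (`ρ² ≤ t' ≤ T`) and `A(Q(z', ρ)) ≤ K`, then
`∫_{B(x',ρ)} |u(s)|² ≤ ρK` for EVERY `s ∈ (t' − ρ², t')` (the tree's Fatou argument
`SereginZajaczkowski2007.forall_setLIntegral_le_of_ae`). [folklore] -/
theorem lintegral_ball_le_of_cknAEss_le {T : ℝ}
    {u : ℝ → EuclideanSpace ℝ (Fin 3) → EuclideanSpace ℝ (Fin 3)}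
    (hcont : ContinuousOn (uncurry u) (Ico 0 T ×ˢ (univ : Set (EuclideanSpace ℝ (Fin 3)))))
    {z' : ℝ × EuclideanSpace ℝ (Fin 3)} {ρ : ℝ} (hρ : 0 < ρ) (hz'T : z'.1 ≤ T) (hz'0 : ρ ^ 2 ≤ z'.1)
    {K : ℝ≥0∞} (hA : cknAEss ρ z' u ≤ K) :
    ∀ s ∈ Ioo (z'.1 - ρ ^ 2) z'.1, ∫⁻ x in ball z'.2 ρ, ‖u s x‖ₑ ^ 2 ≤ ENNReal.ofReal ρ * K := by
  have hρ0 : ENNReal.ofReal ρ ≠ 0 := (ENNReal.ofReal_pos.2 hρ).ne'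
  have hae : ∀ᵐ s ∂(volume.restrict (Ioo (z'.1 - ρ ^ 2) z'.1)),
      ∫⁻ x in ball z'.2 ρ, ‖u s x‖ₑ ^ 2 ≤ ENNReal.ofReal ρ * K := by
    have h1 : ∀ᵐ s ∂(volume.restrict (Ioo (z'.1 - ρ ^ 2) z'.1)),
        (ENNReal.ofReal ρ)⁻¹ * ∫⁻ x in ball z'.2 ρ, ‖u s x‖ₑ ^ 2 ≤ cknAEss ρ z' u := by
      rw [cknAEss]
      exact ENNReal.ae_le_essSup _
    filter_upwards [h1] with s hs
    calc ∫⁻ x in ball z'.2 ρ, ‖u s x‖ₑ ^ 2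
        = ENNReal.ofReal ρ * ((ENNReal.ofReal ρ)⁻¹ * ∫⁻ x in ball z'.2 ρ, ‖u s x‖ₑ ^ 2) := by
          rw [← mul_assoc, ENNReal.mul_inv_cancel hρ0 ENNReal.ofReal_ne_top, one_mul]
      _ ≤ ENNReal.ofReal ρ * K := mul_le_mul' le_rfl (hs.trans hA)
  have hV : ContinuousOn (uncurry u) (Ioo (z'.1 - ρ ^ 2) z'.1 ×ˢ ball z'.2 ρ) := by
    refine hcont.mono (prod_mono (fun s hs => ⟨?_, ?_⟩) (subset_univ _))
    · linarith [hs.1]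
    · exact lt_of_lt_of_le hs.2 hz'T
  exact SereginZajaczkowski2007.forall_setLIntegral_le_of_ae isOpen_Ioo measurableSet_ball hV hae

end Summit.NavierStokesRegularity.NavierStokesRegularity.Theorems.StrainDoors

end
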